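import Literature.Computability.AlgebraicComplexity.RazElusiveGeneralDefinable
import Literature.Computability.AlgebraicComplexity.TavenasVnWitness

/-!
# Valiant's criterion in the shape of Raz's Def. 1.3, for multilinear bit-selector mappings

Support file for item `MomentCurveDefinable` (route GirthSidon, `stmt-ValiantsHypothesis-6544`);
the closing theorem is `momentCurveDefinable_proof` in `…GirthSidonMomentCurveDefinable.lean`.

Setting (Raz 2010, remark after Def. 1.3; Bürgisser 2000, Prop. 2.20 = Valiant's criterion): a
coordinate `f_i(x) = ∏_{j<n} (x_j if c_j(i) = 1 else 1)` of a multilinear `{0,1}`-mapping is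
determined by the bit vector `c(i) ∈ {0,1}ⁿ`, and if `c(i)` is computed from the bits of `i` by a
polynomial-size Boolean circuit then the mapping is poly(`n`)-definable. Here this is carried out
over the tree's straight-line `B₂`-programs (`GateList.Realizes`) and transcript arithmetisation
(`CircuitArith.validPoly`): for a datum `Λ` (a realised program computing
`D : (Fin K → Bool) → (Fin n → Bool)`), the witness
`G = VALID(Q)(w, e) · ∏_{j<n} (1 + W_{out j}(w, e) · (x_j - 1))` in the variables
`((x ⊕ e) ⊕ w)` of `IsPolyDefinableMap` satisfies, for every index `i`,
`∑_{e ∈ {0,1}^L} G(x, e, bits i) = ∏_{j<n} (x_j if D(bits i)_j else 1)` (`boolSum_aeval_G`),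
with `L(G) ≤ 60 L + 4 n + 1` (`complexity_G_le`) and `deg G ≤ 3 L + 2 n` (`totalDegree_G_le`),
`L` the number of gates. All statements are folklore bookkeeping over the tree's circuit model.
-/

noncomputable section

open MvPolynomial

-- D-0017 layout `Summit.<Summit>.<Sub>.Theorems` with Sub = Summit: the duplicated component is intended.
set_option linter.dupNamespace false

namespace Summit.ValiantsHypothesis.ValiantsHypothesis.Theorems

open Literature.Computability.AlgebraicComplexity Literature.Computability.Complexity
  CircuitArith RazDefinable

namespace GirthSidonBitDef

universe u

/-- The data of a realised multi-output `B₂`-program computing the bit map `D` of a multilinear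
`{0,1}`-mapping with `n ≥ 1` coordinates from the `K` bits of the index. [folklore] -/
structure BitDatum where
  /-- number of `x`-variables (and of output bits) -/
  n : ℕ
  /-- number of index bits (`w`-variables) -/
  K : ℕ
  hn : 1 ≤ n
  /-- the gates of the program -/
  gs : List (Gate (Fin K))
  /-- its `n` output wires -/
  out : Fin n → Fin K ⊕ ℕ
  /-- the bit map it computes -/
  D : (Fin K → Bool) → Fin n → Bool
  real : GateList.Realizes B2 gs out D

namespace BitDatum

variable (Λ : BitDatum) (k : Type u) [CommRing k]

/-- The program as a (single-output) `Circuit`; the designated output wire plays no role.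
[folklore] -/
def Q : Circuit (Fin Λ.K) where
  gates := Λ.gs
  output := Λ.out ⟨0, Λ.hn⟩
  wf j hj a m ha := Λ.real.wf j _ (List.getElem?_eq_getElem hj) a m ha
  wf_output m hm := Λ.real.outOK _ m hm

/-- The number of gates (= number of `e`-variables of the witness). [folklore] -/
abbrev L : ℕ := Λ.Q.size

/-- The variables `((x ⊕ e) ⊕ w)` of Raz's Def. 1.3. [folklore] -/
abbrev Vars : Type := (Fin Λ.n ⊕ Fin Λ.L) ⊕ Fin Λ.K

/-- Placing the variables `(w, e)` of the transcript polynomial. [folklore] -/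
def ρ : Fin Λ.K ⊕ Fin Λ.L → Λ.Vars :=
  Sum.elim (fun t => Sum.inr t) fun u => Sum.inl (Sum.inr u)

/-- `VALID(Q)(w, e)`, the transcript consistency polynomial. [folklore] -/
def VP : MvPolynomial Λ.Vars k := rename Λ.ρ (validPoly (k := k) Λ.Q)

/-- The polynomial of output wire `j`. [folklore] -/
def wP (j : Fin Λ.n) : MvPolynomial Λ.Vars k := rename Λ.ρ (wirePoly (k := k) Λ.L (Λ.out j))

/-- The selector factor `1 + W_j (x_j - 1)`. [folklore] -/
def selF (j : Fin Λ.n) : MvPolynomial Λ.Vars k :=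
  1 + Λ.wP k j * (X (Sum.inl (Sum.inl j)) + -1)

/-- The selector `∏_j (1 + W_j (x_j - 1))`. [folklore] -/
def SEL : MvPolynomial Λ.Vars k := ∏ j : Fin Λ.n, Λ.selF k j

/-- **The witness** `G = VALID · SEL`. [folklore] -/
def G : MvPolynomial Λ.Vars k := Λ.VP k * Λ.SEL k

/-- The substitution seen by `G` under the index bits `b` and a transcript guess `e`. [folklore] -/
def θ (b : Fin Λ.K → Bool) (e : Fin Λ.L → Bool) : Λ.Vars → MvPolynomial (Fin Λ.n) k :=
  Sum.elim (Sum.elim (fun j => X j) fun u => C (toK k (e u))) fun t => C (toK k (b t))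

variable {k}

section Eval

variable (b : Fin Λ.K → Bool) (e : Fin Λ.L → Bool)

/-- Along `ρ` the substitution is the Boolean point `(b, e)`. [folklore] -/
theorem θ_comp_ρ : (Λ.θ k b e) ∘ Λ.ρ = fun v => C (bpt k b e v) := by
  funext v
  rcases v with t | u <;> rfl

/-- `VP` becomes the transcript indicator. [folklore] -/
theorem aeval_θ_VP : aeval (Λ.θ k b e) (Λ.VP k) = C (eval (bpt k b e) (validPoly (k := k) Λ.Q)) := by
  unfold VP
  rw [aeval_rename, θ_comp_ρ]
  exact BoolGadgets.aeval_C_comp _ _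

/-- The wire polynomial becomes the Boolean wire value. [folklore] -/
theorem aeval_θ_wP (j : Fin Λ.n) :
    aeval (Λ.θ k b e) (Λ.wP k j) = C (toK k (bwval b e (Λ.out j))) := by
  unfold wP
  rw [aeval_rename, θ_comp_ρ, BoolGadgets.aeval_C_comp, eval_wirePoly]

/-- The selector factor under the substitution (`TavenasVn.sel_factor`: `1 + [c] (P - 1)` is `P`
or `1`). [folklore] -/
theorem aeval_θ_selF (j : Fin Λ.n) :
    aeval (Λ.θ k b e) (Λ.selF k j) = if bwval b e (Λ.out j) then X j else 1 := by
  unfold selF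
  rw [map_add, map_one, map_mul, aeval_θ_wP, map_add, map_neg, map_one, aeval_X]
  exact TavenasVn.sel_factor _ _

/-- The selector under the substitution. [folklore] -/
theorem aeval_θ_SEL :
    aeval (Λ.θ k b e) (Λ.SEL k) = ∏ j : Fin Λ.n, (if bwval b e (Λ.out j) then X j else 1) := by
  unfold SEL
  rw [map_prod]
  exact Finset.prod_congr rfl fun j _ => Λ.aeval_θ_selF b e j

/-- The witness under the substitution. [folklore] -/
theorem aeval_θ_G : aeval (Λ.θ k b e) (Λ.G k) =
    C (eval (bpt k b e) (validPoly (k := k) Λ.Q)) *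
      ∏ j : Fin Λ.n, (if bwval b e (Λ.out j) then X j else 1) := by
  unfold G
  rw [map_mul, aeval_θ_VP, aeval_θ_SEL]

end Eval

/-- **The transcript sum**: `∑_e G(x, e, b) = ∏_j (x_j if D(b)_j else 1)`. [folklore] -/
theorem sum_aeval_θ_G (b : Fin Λ.K → Bool) :
    ∑ e : Fin Λ.L → Bool, aeval (Λ.θ k b e) (Λ.G k) =
      ∏ j : Fin Λ.n, (if Λ.D b j then (X j : MvPolynomial (Fin Λ.n) k) else 1) := by
  simp only [aeval_θ_G]
  rw [sum_C_validPoly_mul Λ.Q (fun g hg => Λ.real.isOver g hg) b fun e =>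
    ∏ j : Fin Λ.n, (if bwval b e (Λ.out j) then (X j : MvPolynomial (Fin Λ.n) k) else 1)]
  refine Finset.prod_congr rfl fun j _ => ?_
  rw [bwval_trueTranscript]
  have h := Λ.real.eval b j
  exact congrArg (fun c : Bool => if c then (X j : MvPolynomial (Fin Λ.n) k) else 1) h

/-- **Valiant's criterion in the shape of Def. 1.3**: substituting the bits of `i` for `w` and
summing `G` over the Boolean values of `e` gives the selector product of `D(bits i)`. [folklore] -/
theorem boolSum_aeval_G (i : ℕ) :
    boolSum (aeval (Sum.elim X fun t : Fin Λ.K =>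
        if i.testBit t then (1 : MvPolynomial (Fin Λ.n ⊕ Fin Λ.L) k) else 0) (Λ.G k)) =
      ∏ j : Fin Λ.n, (if Λ.D (fun t => i.testBit t) j then (X j : MvPolynomial (Fin Λ.n) k) else 1) := by
  rw [← sum_aeval_θ_G]
  unfold boolSum
  refine Finset.sum_congr rfl fun e _ => ?_
  rw [← AlgHom.comp_apply, comp_aeval]
  congr 1
  refine congrArg _ (funext fun v => ?_)
  rcases v with (j | u) | t
  · simp [θ]
  · simp only [θ, Sum.elim_inl, Sum.elim_inr, aeval_X]
    cases e u <;> simp [toK]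
  · simp only [θ, Sum.elim_inr]
    cases i.testBit t <;> simp [toK]

/-! ### Size and degree of the witness -/

/-- `L(selF j) ≤ 3`. [folklore] -/
theorem complexity_selF_le (j : Fin Λ.n) : complexity (Λ.selF k j) ≤ 3 := by
  unfold selF
  have h1 : complexity (Λ.wP k j) ≤ 0 :=
    (complexity_rename_le_holds' _ _).trans_eq (complexity_wirePoly _)
  have h2 : complexity (X (Sum.inl (Sum.inl j)) + -1 : MvPolynomial Λ.Vars k) ≤ 1 := by
    calc complexity (X (Sum.inl (Sum.inl j)) + -1 : MvPolynomial Λ.Vars k)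
        ≤ complexity (X (Sum.inl (Sum.inl j)) : MvPolynomial Λ.Vars k) +
            complexity (-1 : MvPolynomial Λ.Vars k) + 1 := complexity_add_le_holds _ _
      _ ≤ 1 := by
          rw [complexity_X_holds, show (-1 : MvPolynomial Λ.Vars k) = C (-1) by
            rw [C_neg, C_1], complexity_C_holds]
  have h3 : complexity (1 : MvPolynomial Λ.Vars k) = 0 := by
    rw [← C_1]; exact complexity_C_holds _
  calc complexity (1 + Λ.wP k j * (X (Sum.inl (Sum.inl j)) + -1))
      ≤ complexity (1 : MvPolynomial Λ.Vars k) +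
          complexity (Λ.wP k j * (X (Sum.inl (Sum.inl j)) + -1)) + 1 := complexity_add_le_holds _ _
    _ ≤ complexity (1 : MvPolynomial Λ.Vars k) +
          (complexity (Λ.wP k j) + complexity (X (Sum.inl (Sum.inl j)) + -1 : MvPolynomial Λ.Vars k)
            + 1) + 1 := by
        gcongr; exact complexity_mul_le_holds _ _
    _ ≤ 3 := by omega

/-- `L(SEL) ≤ 4 n`. [folklore] -/
theorem complexity_SEL_le : complexity (Λ.SEL k) ≤ 4 * Λ.n := by
  unfold SEL
  refine (complexity_finset_prod_le _ _).trans ?_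
  calc ∑ j : Fin Λ.n, complexity (Λ.selF k j) + (Finset.univ : Finset (Fin Λ.n)).card
      ≤ ∑ _j : Fin Λ.n, 3 + (Finset.univ : Finset (Fin Λ.n)).card := by
        gcongr with j; exact Λ.complexity_selF_le j
    _ = 4 * Λ.n := by
        simp only [Finset.sum_const, Finset.card_univ, Fintype.card_fin, smul_eq_mul]; ring

/-- **`L(G) ≤ 60 L + 4 n + 1`.** [folklore] -/
theorem complexity_G_le : complexity (Λ.G k) ≤ 60 * Λ.L + 4 * Λ.n + 1 := by
  unfold G
  have h1 : complexity (Λ.VP k) ≤ 60 * Λ.L :=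
    (complexity_rename_le_holds' _ _).trans (complexity_validPoly_le Λ.Q)
  have h2 := Λ.complexity_SEL_le (k := k)
  calc complexity (Λ.VP k * Λ.SEL k) ≤ complexity (Λ.VP k) + complexity (Λ.SEL k) + 1 :=
        complexity_mul_le_holds _ _
    _ ≤ 60 * Λ.L + 4 * Λ.n + 1 := by omega

/-- `deg (selF j) ≤ 2`. [folklore] -/
theorem totalDegree_selF_le (j : Fin Λ.n) : (Λ.selF k j).totalDegree ≤ 2 := by
  unfold selF
  have h1 : (Λ.wP k j).totalDegree ≤ 1 :=
    (totalDegree_rename_le _ _).trans (totalDegree_wirePoly_le _)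
  have h2 : (X (Sum.inl (Sum.inl j)) + -1 : MvPolynomial Λ.Vars k).totalDegree ≤ 1 := by
    refine (totalDegree_add _ _).trans (max_le (totalDegree_X_le_one' (k := k) _) ?_)
    rw [totalDegree_neg, totalDegree_one]; exact Nat.zero_le _
  refine (totalDegree_add _ _).trans (max_le ?_ ?_)
  · rw [totalDegree_one]; exact Nat.zero_le _
  · refine (totalDegree_mul _ _).trans ?_
    omega

/-- `deg SEL ≤ 2 n`. [folklore] -/
theorem totalDegree_SEL_le : (Λ.SEL k).totalDegree ≤ 2 * Λ.n := by
  unfold SEL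
  refine (totalDegree_finsetProd _ _).trans ?_
  calc ∑ j : Fin Λ.n, (Λ.selF k j).totalDegree ≤ ∑ _j : Fin Λ.n, 2 :=
        Finset.sum_le_sum fun j _ => Λ.totalDegree_selF_le j
    _ = 2 * Λ.n := by
        simp only [Finset.sum_const, Finset.card_univ, Fintype.card_fin, smul_eq_mul]; ring

/-- **`deg G ≤ 3 L + 2 n`.** [folklore] -/
theorem totalDegree_G_le : (Λ.G k).totalDegree ≤ 3 * Λ.L + 2 * Λ.n := by
  unfold G
  refine (totalDegree_mul _ _).trans (add_le_add ?_ Λ.totalDegree_SEL_le)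
  exact (totalDegree_rename_le _ _).trans (totalDegree_validPoly_le Λ.Q)

end BitDatum

end GirthSidonBitDef

end Summit.ValiantsHypothesis.ValiantsHypothesis.Theorems

end
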